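import Summits.FinalStateConjecture.FinalStateConjecture.Theorems.BartnikGapSettlingBondiBartnikRigidityExactChartGluing
import Literature.Geometry.Lorentzian.CausalityPushUp
import Literature.Geometry.Lorentzian.CausalityAchronalProofs
import Literature.Geometry.Lorentzian.ConvergenceTransport
import Literature.Geometry.Lorentzian.KerrSchildChartCovariance
import Literature.Geometry.Lorentzian.LocalIsometryJetRigidity
import Literature.Geometry.Lorentzian.HypersurfaceRestriction
import Literature.Geometry.Lorentzian.KerrHyperboloidalLeaves
import Literature.Geometry.Manifold.InjOnLocalDiffeomorphInverse
import HarnessLib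

/-!
# K2b-4 `ExactChartPastSet` (stub `stub_exactChartPastSet`) — line `direct-method-on-the-cone`
# (crux `BondiBartnikRigidity`, stmt-FinalStateConjecture-10807)

The past-set transfer lemma of the marching route to the corrected F5 (`K2Route.ExactChartPastSet`,
`…RouteMarchingDefs.lean`), PROVED: the image `Ψ(pullK P)` of an exact, time-orientation preserving
chart on the pull-back of an open Kerr-side region `P ⊆ J⁺_K(slab)°`, past-closed in the closed form,
is past-closed in `I⁺(C)`.  Ingredients (proved here or in the tree): order-`0` exactness as a pointwise
isometry (`K2Route.metric_mfderiv_eq_bilin_of_supCkENorm_le_zero`); pointwise timecone lemmas for an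
isometric differential; lifting of causal curves through a smooth injective immersion on an open set
(Lee 2013, Thm. 4.5, `…Manifold.contMDiffAt_invFunOn_of_bijective_mfderiv`); continuous induction on
the parameter; push-up (O'Neill 1983, Cor. 14.1); achronality of `range 𝒱.embed` (Lemma 14.29);
openness of `I⁺`.  References: [HawkingEllis1973CUP] §6.5; [ONeillSemiRiemannian1983] Ch. 5, Ch. 14;
[LeeSmoothManifolds2013] Thm. 4.5.  No definitions, no named facts.
-/

noncomputable section

-- D-0017: single-problem summit, `Summit.<S>.<S>.…` by design (cf. lakefile `weak.linter.dupNamespace`).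
set_option linter.dupNamespace false
set_option maxSynthPendingDepth 3

open Set Filter Function Topology TopologicalSpace Bundle
open Literature.Geometry.Lorentzian
open scoped Manifold ContDiff Topology ENNReal

namespace Summit.FinalStateConjecture.FinalStateConjecture.Theorems.BondiBartnikRigidity.DirectMethod

namespace K2Route

namespace PastSet

section Generic

open LorentzianMetric

variable {E : Type*} [NormedAddCommGroup E] [NormedSpace ℝ E] {H : Type*} [TopologicalSpace H]
  {I : ModelWithCorners ℝ E H} {n : ℕ∞ω} {M : Type*} [TopologicalSpace M] [ChartedSpace H M]
  [IsManifold I ∞ M] {E' : Type*} [NormedAddCommGroup E'] [NormedSpace ℝ E'] {H' : Type*}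
  [TopologicalSpace H'] {I' : ModelWithCorners ℝ E' H'} {N : Type*} [TopologicalSpace N]
  [ChartedSpace H' N] [IsManifold I' ∞ N] {g : LorentzianMetric I n M} {τ : TimeOrientation g}
  {gN : LorentzianMetric I' n N} {τN : TimeOrientation gN}

/-- **Pointwise timecone lemma for an isometric differential**: if `dφ_y` preserves scalar products
and sends the orienting vector at `y` into the future cone, it sends every future-directed vector at
`y` to a future-directed vector. [cite: ONeillSemiRiemannian1983, Ch. 5, p. 145] -/
theorem isFutureDirected_mfderiv_pt {φ : N → M} {y : N}
    (hkey : ∀ u w : TangentSpace I' y,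
      g.val (φ y) (mfderiv I' I φ y u) (mfderiv I' I φ y w) = gN.val y u w)
    (hT : τ.IsFutureDirected (mfderiv I' I φ y (τN.vectorField y)))
    {v : TangentSpace I' y} (hv : τN.IsFutureDirected v) :
    τ.IsFutureDirected (mfderiv I' I φ y v) := by
  have hTt : g.IsTimelike (mfderiv I' I φ y (τN.vectorField y)) := by
    rw [LorentzianMetric.isTimelike_iff, hkey]; exact τN.isTimelike y
  have hvc : g.IsCausal (mfderiv I' I φ y v) := by
    refine ⟨by rw [hkey]; exact hv.1.1, fun h0 ↦ hv.1.2 (gN.nondegenerate y v fun w ↦ ?_)⟩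
    rw [← hkey, h0, map_zero, _root_.zero_apply]
  exact τ.isFutureDirected_of_val_lt_zero hT hTt hvc (by rw [hkey]; exact hv.2)

/-- **Pointwise converse timecone lemma, reversed orientations**: under the same two pointwise
hypotheses a vector whose image under `dφ_y` is past-directed is past-directed.
[cite: ONeillSemiRiemannian1983, Ch. 5, p. 145] -/
theorem reverse_isFutureDirected_of_mfderiv_pt {φ : N → M} {y : N}
    (hkey : ∀ u w : TangentSpace I' y,
      g.val (φ y) (mfderiv I' I φ y u) (mfderiv I' I φ y w) = gN.val y u w)
    (hT : τ.IsFutureDirected (mfderiv I' I φ y (τN.vectorField y)))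
    {v : TangentSpace I' y} (hv : τ.reverse.IsFutureDirected (mfderiv I' I φ y v)) :
    τN.reverse.IsFutureDirected v := by
  rw [TimeOrientation.isFutureDirected_reverse_iff] at hv ⊢
  have hvc : gN.IsCausal v :=
    ⟨by rw [← hkey]; exact hv.1.1, fun h0 ↦ hv.1.2 (by rw [h0, map_zero])⟩
  rcases τN.isFutureDirected_or_isPastDirected_of_isCausal hvc with h | h
  · exact absurd hv (τ.not_isPastDirected_of_isFutureDirected
      (isFutureDirected_mfderiv_pt hkey hT h))
  · exact h

/-- **Push-up along a past-directed causal curve**: if a future causal curve of the REVERSED time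
orientation on `[a, b]` ends in `I⁺(C)`, all its points lie in `I⁺(C)` (`c ≪ γ b ≤ γ s` gives `c ≪ γ s`,
O'Neill's Cor. 14.1 time-dually). [cite: ONeillSemiRiemannian1983, Ch. 14, Cor. 14.1 (p. 402)] -/
theorem mem_chronologicalFuture_of_reverse_curve [BoundarylessManifold I M] [FiniteDimensional ℝ E]
    (hn : 1 ≤ n) {C : Set M} {γ : ℝ → M} {a b : ℝ}
    (hγ : g.IsFutureCausalCurveOn τ.reverse γ (Icc a b))
    (hq : γ b ∈ g.chronologicalFuture τ C) {s : ℝ} (hs : s ∈ Icc a b) :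
    γ s ∈ g.chronologicalFuture τ C := by
  obtain ⟨c, hc, μ, a', b', hab', hμ, hμa, hμb⟩ := hq
  have hc' : c ∈ g.chronologicalFuture τ.reverse {γ b} :=
    mem_chronologicalPast_of_mem_chronologicalFuture ⟨c, rfl, μ, a', b', hab', hμ, hμa, hμb⟩
  have hJ : γ b ∈ g.causalFuture τ.reverse {γ s} := by
    rcases hs.2.eq_or_lt with h | h
    · rw [h]; exact Or.inl rfl
    · exact Or.inr ⟨γ s, rfl, γ, s, b, h, hγ.mono (Icc_subset_Icc hs.1 le_rfl), rfl, rfl⟩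
  exact chronologicalFuture_mono (singleton_subset_iff.2 hc)
    (mem_chronologicalFuture_of_mem_chronologicalPast
      (mem_chronologicalFuture_of_mem_causalFuture (τ := τ.reverse) hn hJ hc'))

variable [FiniteDimensional ℝ E'] [I'.Boundaryless] [I.Boundaryless]

/-- **Lifting future causal curves through a smooth injective immersion on an open set.**  Let
`φ : N → M` be `C^∞` and injective on the open set `U` with bijective differentials there, such that at
points of `U` a vector is future-directed as soon as its image under `dφ` is.  A future causal curve of
`M` on `s` with values in `φ(U)` lifts to the future causal curve `(φ|_U)⁻¹ ∘ γ` of `N` on `s` (locally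
the composite with the smooth local inverse, Lee 2013, Thm. 4.5). [cite: LeeSmoothManifolds2013, Thm. 4.5] -/
theorem isFutureCausalCurveOn_invFunOn_comp [Nonempty N] {φ : N → M} {U : Set N} (hU : IsOpen U)
    (hφ : ContMDiffOn I' I ∞ φ U) (hinj : InjOn φ U)
    (hbij : ∀ y ∈ U, Bijective (mfderiv I' I φ y))
    (hcone : ∀ y ∈ U, ∀ v : TangentSpace I' y,
      τ.IsFutureDirected (mfderiv I' I φ y v) → τN.IsFutureDirected v)
    {γ : ℝ → M} {s : Set ℝ} (hγ : g.IsFutureCausalCurveOn τ γ s) (hs : ∀ t ∈ s, γ t ∈ φ '' U) :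
    gN.IsFutureCausalCurveOn τN (invFunOn φ U ∘ γ) s := by
  intro t ht
  set G : M → N := invFunOn φ U with hG
  have hyU : G (γ t) ∈ U := Literature.Geometry.Manifold.invFunOn_mem (hs t ht)
  have hφy : φ (G (γ t)) = γ t := Literature.Geometry.Manifold.apply_invFunOn (hs t ht)
  have hγd : MDifferentiableAt 𝓘(ℝ, ℝ) I γ t := (hγ t ht).1
  have hGd : MDifferentiableAt I I' G (γ t) := by
    have h := (Literature.Geometry.Manifold.contMDiffAt_invFunOn_of_bijective_mfderiv hU hφ hinj
      hbij hyU).mdifferentiableAt (by simp)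
    rwa [hφy] at h
  refine ⟨hGd.comp t hγd, hcone _ hyU _ ?_⟩
  have hv : mfderiv I' I φ (G (γ t)) (velocity I' (G ∘ γ) t) = velocity I γ t := by
    have hgen : ∀ (p : M) (_ : p = φ (G (γ t))) (u : TangentSpace I p),
        mfderiv I' I φ (G (γ t)) (mfderiv I I' G p u) = u := by
      rintro p rfl u
      exact Literature.Geometry.Manifold.mfderiv_comp_mfderiv_invFunOn hU hφ hinj hbij hyU u
    rw [show velocity I' (G ∘ γ) t = mfderiv I I' G (γ t) (velocity I γ t) by
      unfold velocity; rw [mfderiv_comp t hGd hγd]; rfl]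
    exact hgen (γ t) hφy.symm (velocity I γ t)
  have hgen : ∀ p, p = γ t → τ.IsFutureDirected (x := p) (velocity I γ t) := by
    rintro p rfl
    exact (hγ t ht).2
  rw [hv]
  exact hgen _ hφy

end Generic

/-- **A cluster value of `f ∘ δ` along a filter on which `f ∘ δ` agrees with a convergent `γ` is the
limit of `γ`** (Hausdorff target; `f` continuous at the cluster point within a set containing the
values of `δ`). [folklore] -/
theorem apply_eq_of_mapClusterPt {α X Y : Type*} [TopologicalSpace X] [TopologicalSpace Y]
    [T2Space Y] {F : Filter α} {δ : α → X} {z : X} (hz : MapClusterPt z F δ) {f : X → Y}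
    {D : Set X} (hf : ContinuousWithinAt f D z) (hD : ∀ᶠ i in F, δ i ∈ D) {γ : α → Y}
    (hγδ : ∀ᶠ i in F, f (δ i) = γ i) {y : Y} (hγ : Tendsto γ F (𝓝 y)) : f z = y := by
  by_contra hne
  obtain ⟨Uf, Uy, hUf, hUy, hzU, hyU, hdisj⟩ := t2_separation hne
  obtain ⟨V, hV, hVsub⟩ := mem_nhdsWithin_iff_exists_mem_nhds_inter.mp (hf (hUf.mem_nhds hzU))
  have hfr : ∃ᶠ i in F, δ i ∈ V := (mapClusterPt_iff_frequently.mp hz) V hV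
  obtain ⟨i, hiV, hiD, hiγ, hiy⟩ :=
    (hfr.and_eventually (hD.and (hγδ.and (hγ (hUy.mem_nhds hyU))))).exists
  have hmem : f (δ i) ∈ Uf := hVsub ⟨hiV, hiD⟩
  rw [hiγ] at hmem
  exact Set.disjoint_left.mp hdisj hmem hiy

/-- **Continuous induction along a parameter interval**: if `γ a ∈ V`, `V` is open, `γ` is continuous
at every point of `[a, b]`, and `γ s ∈ V` whenever `γ([a, s)) ⊆ V` (`a < s ≤ b`), then `γ([a, b]) ⊆ V`
(the first bad parameter would be a bad limit of good ones). [folklore] -/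
theorem forall_mem_of_forall_Ico_mem {Y : Type*} [TopologicalSpace Y] {γ : ℝ → Y} {V : Set Y}
    {a b : ℝ} (hV : IsOpen V) (hγc : ∀ t ∈ Icc a b, ContinuousAt γ t) (ha : γ a ∈ V)
    (hstep : ∀ s ∈ Ioc a b, (∀ t ∈ Ico a s, γ t ∈ V) → γ s ∈ V) : ∀ t ∈ Icc a b, γ t ∈ V := by
  by_contra hbad
  simp only [not_forall, exists_prop] at hbad
  obtain ⟨t₀, ht₀, ht₀V⟩ := hbad
  set Bad : Set ℝ := Icc a b ∩ γ ⁻¹' Vᶜ with hBad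
  have hcl : IsClosed Bad :=
    ContinuousOn.preimage_isClosed_of_isClosed (fun t ht => (hγc t ht).continuousWithinAt)
      isClosed_Icc hV.isClosed_compl
  have hbdd : BddBelow Bad := ⟨a, fun t ht => ht.1.1⟩
  have hs : sInf Bad ∈ Bad := hcl.csInf_mem ⟨t₀, ht₀, ht₀V⟩ hbdd
  have hsa : sInf Bad ≠ a := fun h => hs.2 (by rw [h]; exact ha)
  refine hs.2 (hstep (sInf Bad) ⟨lt_of_le_of_ne hs.1.1 (Ne.symm hsa), hs.1.2⟩ fun t ht => ?_)
  by_contra htV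
  exact absurd ht.2 (not_lt.mpr (csInf_le hbdd ⟨⟨ht.1, ht.2.le.trans hs.1.2⟩, htV⟩))

/-! ### The past-set transfer lemma -/

section Main

open LorentzianMetric

set_option maxHeartbeats 1600000 in
/-- **`ExactChartPastSet` holds** (step (C) of the marching route to the corrected F5).  For
`x ∈ pullK P` and `q ∈ J⁻(Ψ x) ∩ I⁺(C)`, a past-directed causal curve `γ` of `𝒱` from `Ψ x` to `q`
stays in the open set `Ψ(pullK P)`: by continuous induction it suffices that `γ s ∈ Ψ(pullK P)` once
`γ([a, s)) ⊆ Ψ(pullK P)`.  On `[a, s)` the curve lifts through the chart (an injective, future-preserving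
isometric immersion of the Kerr star chart on `P`) to a past-directed causal curve of `Kerr.spacetime M a M`
from `x̂` inside `P ⊆ J⁺_K(slab)°`, hence inside the compact `closure J⁻_K(x̂) ∩ closure J⁺_K(slab)`, where
it has a cluster point `z` at `s`, and `γ s = Ψ ẑ` by continuity of `Ψ` up to `P ∪ slab ∪ roof`.  An
interior `z` lies in `P` (past-closedness); a frontier `z` lies on the slab — then `γ s ∈ C ⊆ ι(X)` is
chronologically preceded by a point of `C ⊆ ι(X)` (push-up from `q ∈ I⁺(C)`), against achronality of the
Cauchy hypersurface — or on the roof — then `γ s ∈ ∂J⁺(C)` lies in the open subset `I⁺(C)` of `J⁺(C)`.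
[cite: HawkingEllis1973CUP, §6.5] [cite: ONeillSemiRiemannian1983, Ch. 14, Cor. 14.1 and Lemma 14.29] -/
theorem exactChartPastSet_holds : ExactChartPastSet := by
  intro _ X _ _ _ _ _ _ D 𝒱 M a hM mo B Φ₀ Ψ C P ρ ha hB hΦ₀C hCι hPo hPW h1 h2 h3 hΨs hΨe hΨJ hdev
    htop hcont hslab hroof x hx
  classical
  /- the rest-frame identification `θ : B.domain ≃ Kerr.region a M` and its inverse `θi` -/
  set Λ : E4 ≃L[ℝ] E4 := (mo.1 : E4 ≃L[ℝ] E4) with hΛ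
  set Pm : E4 → E4 := poincareInv mo.1 mo.2 with hPm
  have hPlab : ∀ z : E4, Pm (Λ z + mo.2) = z := fun z => by simp [hPm, hΛ, poincareInv]
  have hlabP : ∀ y : E4, Λ (Pm y) + mo.2 = y := fun y => by simp [hPm, hΛ, poincareInv]
  have hdom : ∀ y : E4, y ∈ B.domain ↔ Pm y ∈ Kerr.region a M := fun y => by rw [hB]; rfl
  have hbil : B.bilin = boostedKerrBilin mo.1 mo.2 M a := by rw [hB]; rfl
  have hPreg : ∀ y : B.domain, Pm y.1 ∈ Kerr.region a M := fun y => (hdom y.1).1 y.2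
  set θ : B.domain → Kerr.region a M := fun y => ⟨Pm y.1, hPreg y⟩ with hθ
  have hlab_mem : ∀ z : Kerr.region a M, Λ z.1 + mo.2 ∈ B.domain := fun z =>
    (hdom _).2 (by rw [hPlab]; exact z.2)
  set θi : Kerr.region a M → B.domain := fun z => ⟨Λ z.1 + mo.2, hlab_mem z⟩ with hθi
  have hθθi : ∀ z, θ (θi z) = z := fun z => Subtype.ext (hPlab z.1)
  have hθiθ : ∀ y, θi (θ y) = y := fun y => Subtype.ext (hlabP y.1)
  have hpull : ∀ S : Set (Kerr.region a M), pullK mo M a B S = θ ⁻¹' S := fun S => by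
    ext y; exact ⟨fun ⟨_, h⟩ => h, fun h => ⟨hPreg y, h⟩⟩
  have hAff : ContDiff ℝ ∞ (fun z : E4 => Λ z + mo.2) := (Λ : E4 →L[ℝ] E4).contDiff.add contDiff_const
  have hAffd : ∀ z : E4, HasFDerivAt (fun z : E4 => Λ z + mo.2) (Λ : E4 →L[ℝ] E4) z := fun z =>
    (Λ : E4 →L[ℝ] E4).hasFDerivAt.add_const _
  have hθis : ContMDiff 𝓘(ℝ, E4) 𝓘(ℝ, E4) ∞ θi := by
    rw [← ContMDiff.subtypeVal_comp_iff]
    exact fun z => contMDiffAt_subtype_iff.2 hAff.contMDiff.contMDiffAt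
  have hθic : Continuous θi := hθis.continuous
  have hdθi : ∀ z : Kerr.region a M, mfderiv 𝓘(ℝ, E4) 𝓘(ℝ, E4) θi z = (Λ : E4 →L[ℝ] E4) := by
    intro z
    have hd : MDifferentiableAt 𝓘(ℝ, E4) 𝓘(ℝ, E4) (fun z : E4 => Λ z + mo.2) z.1 :=
      (hAff.contMDiff.contMDiffAt (x := z.1)).mdifferentiableAt (by simp)
    rw [OpensChart.mfderiv_codRestrict (f := fun z : Kerr.region a M => Λ z.1 + mo.2)
      (fun _ => rfl) ((contMDiffAt_subtype_iff.2 (hAff.contMDiff.contMDiffAt (x := z.1)))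
        |>.mdifferentiableAt (by simp)),
      show (fun z : Kerr.region a M => Λ z.1 + mo.2) = (fun z : E4 => Λ z + mo.2) ∘ Subtype.val
        from rfl, mfderiv_comp_subtypeVal hd, mfderiv_eq_fderiv, (hAffd z.1).fderiv]
  /- the chart on the Kerr side, `Φ = Ψ ∘ θi`: an injective isometric immersion on `P` -/
  have hOP : IsOpen (pullK mo M a B P) := isOpen_pullK_of_eq hB hPo
  have hθiP : ∀ z ∈ P, θi z ∈ pullK mo M a B P := fun z hz => by
    rw [hpull, mem_preimage, hθθi]; exact hz
  have hxP : θ x ∈ P := by rw [hpull] at hx; exact hx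
  have hΨd : ∀ y ∈ pullK mo M a B P, MDifferentiableAt 𝓘(ℝ, E4) (𝓡 4) Ψ y := fun y hy =>
    ((hΨs y hy).contMDiffAt (hOP.mem_nhds hy)).mdifferentiableAt (by simp)
  set Φ : Kerr.region a M → 𝒱.carrier := Ψ ∘ θi with hΦ
  have hΦs : ContMDiffOn 𝓘(ℝ, E4) (𝓡 4) ∞ Φ P := fun z hz =>
    (((hΨs _ (hθiP z hz)).contMDiffAt (hOP.mem_nhds (hθiP z hz))).comp z (hθis z)).contMDiffWithinAt
  have hdΦ : ∀ z ∈ P, ∀ u : E4,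
      mfderiv 𝓘(ℝ, E4) (𝓡 4) Φ z u = mfderiv 𝓘(ℝ, E4) (𝓡 4) Ψ (θi z) (Λ u) := by
    intro z hz u
    rw [hΦ, mfderiv_comp z (hΨd _ (hθiP z hz)) (hθis.mdifferentiableAt (by simp)), hdθi z]
    rfl
  have hexact : ∀ y ∈ pullK mo M a B P, ∀ v w : E4,
      𝒱.metric.val (Ψ y) (mfderiv 𝓘(ℝ, E4) (𝓡 4) Ψ y v) (mfderiv 𝓘(ℝ, E4) (𝓡 4) Ψ y w) =
        Kerr.bilin M a (Pm y.1) (Λ.symm v) (Λ.symm w) := fun y hy v w => by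
    rw [metric_mfderiv_eq_bilin_of_supCkENorm_le_zero hdev hy, hbil, boostedKerrBilin_apply]
  have hkey : ∀ z ∈ P, ∀ u w : E4,
      𝒱.metric.val (Φ z) (mfderiv 𝓘(ℝ, E4) (𝓡 4) Φ z u) (mfderiv 𝓘(ℝ, E4) (𝓡 4) Φ z w) =
        (Kerr.spacetime M a M hM.le).metric.val z u w := by
    intro z hz u w
    rw [hdΦ z hz u, hdΦ z hz w, Kerr.spacetime_metric, Kerr.smoothMetric_val]
    show 𝒱.metric.val (Ψ (θi z)) _ _ = _
    rw [hexact _ (hθiP z hz)]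
    simp only [ContinuousLinearEquiv.symm_apply_apply]
    exact congrArg (fun e : E4 => Kerr.bilin M a e u w) (hPlab z.1)
  have hT : ∀ z ∈ P, 𝒱.timeOrientation.IsFutureDirected (mfderiv 𝓘(ℝ, E4) (𝓡 4) Φ z
      ((Kerr.spacetime M a M hM.le).timeOrientation.vectorField z)) := by
    intro z hz
    have h := htop (θi z) (hθiP z hz)
    rw [show Pm (θi z).1 = z.1 from hPlab z.1] at h
    rw [hdΦ z hz]
    exact h
  have hbij : ∀ z ∈ P, Bijective (mfderiv 𝓘(ℝ, E4) (𝓡 4) Φ z) := fun z hz =>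
    JetRigidity.bijective_of_map_eq (E := E4) (F := E4)
      (q₁ := (Kerr.bilin M a z.1 : E4 →L[ℝ] E4 →L[ℝ] ℝ))
      (q₂ := (𝒱.metric.val (Φ z) : E4 →L[ℝ] E4 →L[ℝ] ℝ))
      (A := (mfderiv 𝓘(ℝ, E4) (𝓡 4) Φ z : E4 →L[ℝ] E4)) rfl
      (Kerr.bilin_nondegenerate M a (Kerr.radius_pos_of_mem_region z.2)) (hkey z hz)
  have hinj : InjOn Φ P := fun z hz z' hz' h => by
    rw [← hθθi z, ← hθθi z', Set.injOn_iff_injective.2 hΨe.injective (hθiP z hz) (hθiP z' hz') h]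
  have hcone : ∀ z ∈ P, ∀ v : E4,
      𝒱.timeOrientation.reverse.IsFutureDirected (mfderiv 𝓘(ℝ, E4) (𝓡 4) Φ z v) →
        (Kerr.spacetime M a M hM.le).timeOrientation.reverse.IsFutureDirected v :=
    fun z hz v hv => reverse_isFutureDirected_of_mfderiv_pt (hkey z hz) (hT z hz) hv
  have hVo : IsOpen (Φ '' P) := Literature.Geometry.Manifold.isOpen_image_of_bijective_mfderiv hPo hΦs hbij
  /- the causal argument -/
  rintro q ⟨hqJ, hqI⟩
  rcases hqJ with hq0 | ⟨p, hp, γ, a₀, b₀, hab, hγ, hγa, hγb⟩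
  · rw [mem_singleton_iff] at hq0; rw [hq0]; exact ⟨x, hx, rfl⟩
  rw [mem_singleton_iff] at hp
  rw [hp] at hγa
  haveI : Nonempty (Kerr.region a M) := ⟨θ x⟩
  have hn1 : (1 : ℕ∞ω) ≤ ((⊤ : ℕ∞) : ℕ∞ω) := WithTop.coe_le_coe.mpr le_top
  have hn2 : (2 : ℕ∞ω) ≤ ((⊤ : ℕ∞) : ℕ∞ω) := WithTop.coe_le_coe.mpr le_top
  have hγI : ∀ s ∈ Icc a₀ b₀, γ s ∈ 𝒱.metric.chronologicalFuture 𝒱.timeOrientation C :=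
    fun s hs => mem_chronologicalFuture_of_reverse_curve hn1 hγ (by rw [hγb]; exact hqI) hs
  have hγc : ∀ t ∈ Icc a₀ b₀, ContinuousAt γ t := fun t ht => hγ.continuousAt ht
  suffices hstep : ∀ s ∈ Ioc a₀ b₀, (∀ t ∈ Ico a₀ s, γ t ∈ Φ '' P) → γ s ∈ Φ '' P by
    obtain ⟨z, hz, hzq⟩ := forall_mem_of_forall_Ico_mem hVo hγc
      (by rw [hγa]; exact ⟨θ x, hxP, congrArg Ψ (hθiθ x)⟩) hstep b₀ (right_mem_Icc.2 hab.le)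
    exact ⟨θi z, hθiP z hz, hzq.trans hγb⟩
  intro s hs hgood
  -- the lift `δ` of `γ|[a₀, s)`: a past-directed causal curve of the Kerr star chart from `θ x`
  set δ : ℝ → Kerr.region a M := invFunOn Φ P ∘ γ with hδ
  have hδP : ∀ t ∈ Ico a₀ s, δ t ∈ P := fun t ht =>
    Literature.Geometry.Manifold.invFunOn_mem (hgood t ht)
  have hΦδ : ∀ t ∈ Ico a₀ s, Φ (δ t) = γ t := fun t ht =>
    Literature.Geometry.Manifold.apply_invFunOn (hgood t ht)
  have ha₀ : a₀ ∈ Ico a₀ s := left_mem_Ico.2 hs.1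
  have hδa : δ a₀ = θ x :=
    hinj (hδP a₀ ha₀) hxP (by rw [hΦδ a₀ ha₀, hγa]; exact (congrArg Ψ (hθiθ x)).symm)
  have hδc : (Kerr.spacetime M a M hM.le).metric.IsFutureCausalCurveOn
      (Kerr.spacetime M a M hM.le).timeOrientation.reverse δ (Ico a₀ s) :=
    isFutureCausalCurveOn_invFunOn_comp hPo hΦs hinj hbij hcone
      (hγ.mono (Ico_subset_Icc_self.trans (Icc_subset_Icc le_rfl hs.2))) hgood
  have hδJ : ∀ t ∈ Ico a₀ s, δ t ∈ JKpast M a hM {θ x} := by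
    intro t ht
    rcases ht.1.eq_or_lt with h | h
    · rw [← h, hδa]; exact Or.inl rfl
    · exact Or.inr ⟨θ x, rfl, δ, a₀, t, h, hδc.mono (Icc_subset_Ico_right ht.2), hδa, rfl⟩
  -- a cluster point `z` of the lift at `s` in the compact truncated past, and `γ s = Ψ (θi z)`
  have hev : ∀ᶠ t in 𝓝[<] s, t ∈ Ico a₀ s := Ico_mem_nhdsLT hs.1
  obtain ⟨z, hzK, hz⟩ := (h3 (θ x) hxP).exists_mapClusterPt_of_frequently (f := δ) (l := 𝓝[<] s)
    ((hev.mono fun t ht => ⟨subset_closure (hδJ t ht),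
      subset_closure (interior_subset (hPW (hδP t ht)))⟩).frequently)
  set Dset : Set B.domain :=
    pullK mo M a B (P ∪ slabK M a ∪ (roofK M a hM ∩ {y | Kerr.radius a y.1 ≤ ρ})) with hDset
  have hPD : pullK mo M a B P ⊆ Dset :=
    pullK_mono _ _ _ _ (subset_union_left.trans subset_union_left)
  have hval : θi z ∈ Dset → Ψ (θi z) = γ s := fun hmem =>
    apply_eq_of_mapClusterPt (hz.continuousAt_comp hθic.continuousAt) (hcont _ hmem)
      (hev.mono fun t ht => hPD (hθiP _ (hδP t ht))) (hev.mono fun t ht => hΦδ t ht)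
      ((hγc s ⟨hs.1.le, hs.2⟩).tendsto.mono_left nhdsWithin_le_nhds)
  -- `z` is an interior or a frontier point of `J⁺_K(slab)`
  have hzcl : z ∈ closure (JK M a hM (slabK M a)) := hzK.2
  rw [closure_eq_interior_union_frontier] at hzcl
  rcases hzcl with hzi | hzf
  · -- interior: `z ∈ P` by past-closedness, so `γ s = Φ z ∈ Φ(P)`
    have hzP : z ∈ P := h1 (θ x) hxP ⟨hzK.1, hzi⟩
    exact ⟨z, hzP, hval (hPD (hθiP z hzP))⟩
  · -- frontier: on the slab or on the roof, both absurd since `γ s ∈ I⁺(C)`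
    exfalso
    have hsI : γ s ∈ 𝒱.metric.chronologicalFuture 𝒱.timeOrientation C := hγI s ⟨hs.1.le, hs.2⟩
    have hz2 := h2 (θ x) hxP ⟨hzK.1, hzf⟩
    have hmem : ∀ S : Set (Kerr.region a M), z ∈ S → θi z ∈ pullK mo M a B S := fun S hS => by
      rw [hpull, mem_preimage, hθθi]; exact hS
    have hΨz : Ψ (θi z) = γ s := hval (hmem _ (hz2.elim (fun h => Or.inl (Or.inr h)) Or.inr))
    rcases hz2 with hzs | hzr
    · -- slab: `γ s = Φ₀ (θi z) ∈ C ⊆ ι(X)` and `γ s ∈ I⁺(C) ⊆ I⁺(ι X)`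
      have hC : γ s ∈ C := by
        rw [← hΨz, hslab _ (hmem _ hzs)]
        exact hΦ₀C ⟨θi z, hmem _ hzs, rfl⟩
      obtain ⟨c, hc, μ, a', b', hab', hμ, hμa, hμb⟩ := hsI
      exact IsCauchyHypersurface.isAchronal_holds hn2 𝒱.isCauchyHypersurface c (hCι hc) (γ s)
        (hCι hC) ⟨c, rfl, μ, a', b', hab', hμ, hμa, hμb⟩
    · -- roof: `γ s ∈ ∂J⁺(C)` yet in the open subset `I⁺(C)` of `J⁺(C)`
      have hfr : γ s ∈ frontier (𝒱.metric.causalFuture 𝒱.timeOrientation C) := by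
        rw [← hΨz]; exact hroof ⟨θi z, hmem _ hzr, rfl⟩
      exact hfr.2 (interior_maximal (chronologicalFuture_subset_causalFuture _ _ C)
        (isOpen_chronologicalFuture_of_boundaryless _ _ C) hsI)

end Main

end PastSet

end K2Route

/-- **Registered stub `stub_exactChartPastSet` of the line `direct-method-on-the-cone`** (K2b-4):
the past-set transfer lemma `K2Route.ExactChartPastSet` of the marching route to the corrected F5 —
the image of an exact, time-orientation preserving chart on a past-closed Kerr-side region is
past-closed in `I⁺(C)`. [cite: HawkingEllis1973CUP, §6.5] -/
theorem stub_exactChartPastSet : K2Route.ExactChartPastSet :=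
  K2Route.PastSet.exactChartPastSet_holds

end Summit.FinalStateConjecture.FinalStateConjecture.Theorems.BondiBartnikRigidity.DirectMethod

end
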